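import Summits.CriticalPhenomena.PercolationContinuityZ3.Theorems.Transplant.SkelFrmBParamsFaceRoomsAR0
import Summits.CriticalPhenomena.PercolationContinuityZ3.Theorems.Transplant.SkelFrmBParamsFaceBandAR0
import Summits.CriticalPhenomena.PercolationContinuityZ3.Theorems.Transplant.SkelFrmBParamsFaceCountsRangeA
import Summits.CriticalPhenomena.PercolationContinuityZ3.Theorems.Transplant.PlanarCells2VFace
import Summits.CriticalPhenomena.PercolationContinuityZ3.Theorems.Transplant.SkelPhiFaceSlots2
import HarnessLib

/-!
# N2 (frames-only node `SamePDropOfSkeletonFrm₁`, OPEN) — (F) column, DISCHARGE LAYER, block **F-K1 (part 2, V): THE FACE-FRAME ROWS OF THE ONE-SIDED FACE KEYSTONE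
# `Skelφ.faceOblRM_of_kits9VC` AT THE ASYMMETRIC-ROOM CELLS `PCells2V`, RE-SIZED TO THE SHIFTED FACE WINDOW (DESIGN W)** — p1-g18 by CLAIM (hp-8 g42 10:59:50Z F-K1;
# (R-48) p3-g17 2026-08-23T14:01:30Z: "F-K1 part 2 re-derives `aw du := faceExt`-based, `kF/kE` accordingly, `frame_hkF` with `+ r⊥`").

THE WINDOW (hp-8 g43 DESIGN W, `PlanarCells2VFace` p368846 = the planar §1 split out of `SkelPhiFaceDataNV` 16:48:03Z): `faceCen x du j ⊥ := cenS x ⊥ + faceSh du`, `faceSh du := sgOf du·⌊(hF∥ − hB∥)/2⌋`, `faceExt du ⊥ := ⌈(hB∥ + hF∥)/2⌉ ≤ 2r⊥`.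
§1 THE RE-SIZED FRAME FUNCTIONALS over `(P : PCells2V)` (twins of hp-8 g33's `Skelφ.FinePrm.awNum/awF₂/kFF₂`, SkelPhiFaceSlots/Slots2, reading `PCells2V.faceExt` instead of
`PCells2.faceExt = 2r⊥`): **`FinePrm.awNumV/awF₂V/kFF₂V`**, `awNumV_eq_axis/awF₂V_eq_axis`, the rows **`haw_awF₂V`**, **`hroomF_kFF₂V`** (proofs verbatim), the closed form
`awNumV_eq` (= FaceA `awNum_eqA` at the new extent `eV I := faceExt (I,true) (oth I) = ⌈(hB I + hF I)/2⌉`) and **the V bound of record `kFF₂V_le_lin : kFF₂V P Rl I ≤ eV I + 5·Rl + 15`**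
(p1-g17's `kFF₂_le_linA` proof re-read with `2r⊥ ↦ eV I`).
§2 THE G6 ROWS OF THE VC KEYSTONE (HOME/prim-hp-8/code/gen43/V/SkelPhiFaceHoldsKits9VC.lean :93–:98) at `g := KS.gT mk gx`, `pr := prFA`, generic `(P : PCells2V)` with
`hP : P.toPCells2 = fcellsA …` (instance: stmt's `fcellsV …`, `fcellsV_toPCells2` rfl): `frame_hRlevV (hMR0) : ∀ i, Rlev0 + 4 ≤ 10·P.s i`, `frame_hRlev'V (hMR0) : ∀ du,
Rlev0 + 5 + P.c du.1 ≤ 3·P.r (oth du.1)`, `frame_hk₀V` (= FaceLatA, P-free), `frame_hk₀'V`, **`frame_hroomFV`** / **`frame_hawV`** at `aw du := (pr.awF₂V P du).toNat`,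
`kF I := pr.kFF₂V P Rlev0 I` (the RE-SIZED window), **`frame_hkFV (hMR0) : ∀ I, kFF₂V P Rlev0 I + 3 + P.c I + P.r (oth I) ≤ 5·P.r (oth I)`** (DESIGN W's `+ r⊥`: `eV ≤ 2r⊥`,
`5·Rlev0 + 18 ≤ r⊥ − c`… precisely `eV + 5Rlev0 + 18 + c + r ≤ 5r` from `eV ≤ 2r`, `c ≤ r`, `5(R'0−1) + 18 ≤ r` (`6R'0+11 ≤ u`, `40u ≤ r`)), `frame_nFcV` (P-free).
`hcount/hE/hM…` = part 1 (`KS0.counts_face_0`, `faceKit_rooms`, p363099 ✓); `hRlev'`/`hkF` read the creep cap off `P` (`PCells2T.c_le_r_oth'` via `P.toPCells2T`).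
NON-VACUITY: binder set = Step I at the tuple + the box floor `hMR0 : 4·K·(R'0+2) ≤ M_L(gT)` (⟸ stmt's `gxQ`) + `hP`; `P := fcellsV …`, `hP := rfl` instantiates it.
builds on p205010 (kernel theorem, internal audit signed; external expert review pending) — nothing here uses p205010; NOTHING is claimed about the open node
`SamePDropOfSkeletonFrm₁`; arithmetic only.
Lane `prim-bschramm`, seat `prim-bschramm-p1` (gen 18); helper file (`--supports stmt-CriticalPhenomena-4575 --as helper`).
[cite: KozmaNitzan2024, §4 Lemma 10 Step IV (pp. 20–21); Lemma 12 (pp. 23–25), p. 30] [cite: MartineauTassion2017, §4.3] [cite: Timar2007, Lemma 2.2, p. 3]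
-/

noncomputable section

open scoped Classical

namespace Summit.CriticalPhenomena.PercolationContinuityZ3.Theorems.Transplant

open Literature.Probability.Percolation Literature.Probability.LatticeModels KNCells
open Literature.Probability.Percolation.KozmaNitzan
open Literature.Probability.Percolation.KozmaNitzan.Cells (oth oth_ne eq_oth_of_ne)
open TwoAxis.Para (modulus detD)

/-! ## §1 The frame functionals over the shifted window -/

namespace Skelφ

namespace FinePrm

variable (pr : FinePrm)

/-- The `aw`-numerator of the shifted face window (DESIGN W extents). [this work] -/
def awNumV (P : PCells2V) (du : MDir) : ℤ :=
  (pr.rdK 1 (pr.bOf du.1) * (P.faceExt du 0 + 1) + pr.rdK 0 (pr.bOf du.1) * (P.faceExt du 1 + 1)) * pr.D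

/-- **`aw` per direction at the shifted window**: `⌈awNumV du / Mabs⌉`. [this work] -/
def awF₂V (P : PCells2V) (du : MDir) : ℤ := (pr.awNumV P du + pr.Mabs - 1) / pr.Mabs

/-- **`kF` per level axis at the shifted window**: `⌈(Mabs·(awF₂V (I, ·) + Rlev + 1) + rdN I (bOf I)·(Rlev+2)·D) / (rdK I (bOf I)·D)⌉`. [this work] -/
def kFF₂V (P : PCells2V) (Rlev : ℕ) (I : Fin 2) : ℤ :=
  (pr.Mabs * (pr.awF₂V P (I, true) + Rlev + 1) + pr.rdN I (pr.bOf I) * (Rlev + 2) * pr.D + pr.rdK I (pr.bOf I) * pr.D - 1) /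
    (pr.rdK I (pr.bOf I) * pr.D)

/-- `awNumV` depends on the axis of the direction only. [folklore] -/
theorem awNumV_eq_axis (P : PCells2V) (du : MDir) : pr.awNumV P du = pr.awNumV P (du.1, true) := by
  unfold awNumV PCells2V.faceExt; rfl

/-- `awF₂V` depends on the axis of the direction only. [folklore] -/
theorem awF₂V_eq_axis (P : PCells2V) (du : MDir) : pr.awF₂V P du = pr.awF₂V P (du.1, true) := by
  unfold awF₂V; rw [pr.awNumV_eq_axis P du]

/-- **`haw` per direction at the shifted window**: `awNumV du ≤ Mabs · (awF₂V du + 1)`. [this work] -/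
theorem haw_awF₂V (hc₀ : 0 < pr.c₀) (hc₁ : 0 < pr.c₁) (hDd : pr.D = detD pr.A pr.n pr.h pr.vα pr.vβ) (hD : 0 < pr.D) (P : PCells2V) (du : MDir) :
    (pr.rdK 1 (pr.bOf du.1) * (P.faceExt du 0 + 1) + pr.rdK 0 (pr.bOf du.1) * (P.faceExt du 1 + 1)) * pr.D ≤ pr.Mabs * (pr.awF₂V P du + 1) := by
  have hM := pr.Mabs_pos hc₀ hc₁ hDd hD
  have h1 := le_mul_cdiv (a := pr.awNumV P du) hM
  show pr.awNumV P du ≤ _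
  unfold awF₂V
  nlinarith

/-- **`hroomF` per direction at the shifted window**: `Mabs·(awF₂V du + Rlev + 1) + rdN du.1 (bOf du.1)·(Rlev+2)·D ≤ rdK du.1 (bOf du.1) · kFF₂V du.1 · D`. [this work] -/
theorem hroomF_kFF₂V (hc₀ : 0 < pr.c₀) (hc₁ : 0 < pr.c₁) (hDd : pr.D = detD pr.A pr.n pr.h pr.vα pr.vβ) (hD : 0 < pr.D) (P : PCells2V) (Rlev : ℕ)
    (du : MDir) : pr.Mabs * (pr.awF₂V P du + Rlev + 1) + pr.rdN du.1 (pr.bOf du.1) * (Rlev + 2) * pr.D ≤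
      pr.rdK du.1 (pr.bOf du.1) * pr.kFF₂V P Rlev du.1 * pr.D := by
  have hK := mul_pos (pr.rdK_pos hc₀ hc₁ hDd hD du.1) hD
  rw [pr.awF₂V_eq_axis P du]
  have h1 := le_mul_cdiv (a := pr.Mabs * (pr.awF₂V P (du.1, true) + Rlev + 1) + pr.rdN du.1 (pr.bOf du.1) * (Rlev + 2) * pr.D) hK
  unfold kFF₂V
  linarith

end FinePrm

end Skelφ

/-! ## §2 The frame rows of the VC keystone at the (ζ′) fine parameters -/

namespace PlanarSkeletonFrm

namespace NegB

open SimpleGraph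
open SkelConc (Consts)
open Skelφ.StepI (DataN)
open Neg

section FrameRowsV

variable (κ : Consts) {V : Type} [DecidableEq V] [Countable V] {G : SimpleGraph V} [G.LocallyFinite] (Φ : PlanarSkeletonFrm G) (t : V) (p : unitInterval)
  (D : Skelφ.StepI.DataNS V) (f : ℕ) (mk : ℕ) (gx : Neg.FSlot)

/-- The shifted window's transverse extent `eV I := faceExt (I, true) (oth I) = ⌈(hB I + hF I)/2⌉` and the axis extent `0`. [folklore] -/
theorem faceExtV_apply (P : PCells2V) (I : Fin 2) :
    P.faceExt (I, true) I = 0 ∧ P.faceExt (I, true) (oth I) = ((P.hB I : ℤ) + P.hF I + 1) / 2 := by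
  constructor
  · simp [PCells2V.faceExt]
  · simp [PCells2V.faceExt, oth_ne]

/-- `0 ≤ eV I ≤ 2·r (oth I)`. [folklore] -/
theorem faceExtV_oth_bounds (P : PCells2V) (I : Fin 2) : 0 ≤ P.faceExt (I, true) (oth I) ∧ P.faceExt (I, true) (oth I) ≤ 2 * (P.r (oth I) : ℤ) := by
  refine ⟨?_, P.faceExt_oth_le (I, true)⟩
  rw [(faceExtV_apply P I).2]
  have h3 : (0 : ℤ) ≤ P.hB I := Nat.cast_nonneg _; have h4 : (0 : ℤ) ≤ P.hF I := Nat.cast_nonneg _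
  omega

/-- **The `aw`-numerator of the shifted window in closed form**: `awNumV P (I,true) = (rdK I (bOf I)·(eV I + 1) + rdN I (bOf I))·D` (FaceA `awNum_eqA` at the new extent). [folklore] -/
theorem awNumV_eq (g : ℕ) (P : PCells2V) (I : Fin 2) :
    (prFA κ Φ t p D g f).awNumV P (I, true) =
      ((prFA κ Φ t p D g f).rdK I ((prFA κ Φ t p D g f).bOf I) * (P.faceExt (I, true) (oth I) + 1) + (prFA κ Φ t p D g f).rdN I ((prFA κ Φ t p D g f).bOf I)) *
        (prFA κ Φ t p D g f).D := by
  set pr := prFA κ Φ t p D g f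
  have e := (faceExtV_apply P I).1
  obtain rfl | rfl : I = 0 ∨ I = 1 := by fin_cases I <;> simp
  · show (pr.rdK 1 (pr.bOf 0) * (P.faceExt (0, true) 0 + 1) + pr.rdK 0 (pr.bOf 0) * (P.faceExt (0, true) 1 + 1)) * pr.D = _
    rw [e, Skelφ.FinePrm.rdN_zero, Skelφ.FinePrm.rdK_one, show oth (0 : Fin 2) = 1 from rfl]; ring
  · show (pr.rdK 1 (pr.bOf 1) * (P.faceExt (1, true) 0 + 1) + pr.rdK 0 (pr.bOf 1) * (P.faceExt (1, true) 1 + 1)) * pr.D = _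
    rw [e, Skelφ.FinePrm.rdN_one, Skelφ.FinePrm.rdK_zero, show oth (1 : Fin 2) = 0 from rfl]; ring

/-- **THE V BOUND OF RECORD — the contact band half-width is linear in the WINDOW extent**: `kFF₂V (prFA) P Rl I ≤ eV I + 5·Rl + 15` at `g := gT` (any `Rl`, both axes;
p1-g17's `kFF₂_le_linA` with `2r⊥ ↦ eV I = ⌈(hB I + hF I)/2⌉`). [cite: KozmaNitzan2024, §4 Lemma 10 Step IV] -/
theorem kFF₂V_le_lin (hN : EqNumL κ Φ t p D (KS.gT mk gx κ Φ t p D) f) (hκ : (hL κ Φ t p D (KS.gT mk gx κ Φ t p D) f).natAbs ≤ 10 * nL κ Φ t p D (KS.gT mk gx κ Φ t p D) f)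
    (P : PCells2V) (Rl : ℕ) (I : Fin 2) :
    (prFA κ Φ t p D (KS.gT mk gx κ Φ t p D) f).kFF₂V P Rl I ≤ P.faceExt (I, true) (oth I) + 5 * Rl + 15 := by
  set pr := prFA κ Φ t p D (KS.gT mk gx κ Φ t p D) f
  have hDpos : 0 < pr.D := prFA_D_pos κ Φ t p D (KS.gT mk gx κ Φ t p D) f hN
  obtain ⟨hc₀, hc₁⟩ := prFA_c_pos κ Φ t p D (KS.gT mk gx κ Φ t p D) f
  have hDd := prFA_D κ Φ t p D (KS.gT mk gx κ Φ t p D) f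
  have hx : 0 < pr.rdK I (pr.bOf I) := rdK_pos_RA κ Φ t p D _ f hN I
  have hM : 0 < pr.Mabs := pr.Mabs_pos hc₀ hc₁ hDd hDpos
  have hy : pr.rdN I (pr.bOf I) ≤ pr.rdK I (pr.bOf I) * 3 := rdN_le_three_rdKA κ Φ t p D _ f hN I (eleven_le_s_TA κ Φ t p D f mk gx hN hκ I)
  have hM2 : pr.Mabs ≤ 2 * pr.rdK I (pr.bOf I) * pr.D := Mabs_le_two_rdK_DA κ Φ t p D _ f hN I
  set aw := pr.awF₂V P (I, true) with haw
  have haw' : pr.Mabs * aw ≤ pr.awNumV P (I, true) + pr.Mabs - 1 := by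
    rw [haw]; unfold Skelφ.FinePrm.awF₂V; exact Int.mul_ediv_self_le hM.ne'
  rw [awNumV_eq] at haw'
  set x := pr.rdK I (pr.bOf I)
  set y := pr.rdN I (pr.bOf I)
  set r := P.faceExt (I, true) (oth I)
  have hr0 : (0 : ℤ) ≤ r := (faceExtV_oth_bounds P I).1
  have hxD : 0 < x * pr.D := mul_pos hx hDpos
  set q := pr.kFF₂V P Rl I with hq
  have hq' : x * pr.D * q ≤ pr.Mabs * (aw + Rl + 1) + y * (Rl + 2) * pr.D + x * pr.D - 1 := by
    rw [hq]; unfold Skelφ.FinePrm.kFF₂V; exact Int.mul_ediv_self_le hxD.ne'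
  have hR0 : (0 : ℤ) ≤ Rl := Nat.cast_nonneg _
  have hyR : y * ((Rl : ℤ) + 2) * pr.D ≤ x * 3 * ((Rl : ℤ) + 2) * pr.D := by
    have : 0 ≤ ((Rl : ℤ) + 2) * pr.D := mul_nonneg (by linarith) hDpos.le
    have hy0 : 0 ≤ y := by
      show 0 ≤ pr.rdN I (pr.bOf I)
      unfold Skelφ.FinePrm.rdN; exact mul_nonneg (pr.cOf_pos hc₀ hc₁ (oth I)).le (abs_nonneg _)
    nlinarith
  have hMR : pr.Mabs * ((Rl : ℤ) + 1) ≤ 2 * x * pr.D * ((Rl : ℤ) + 1) := mul_le_mul_of_nonneg_right hM2 (by linarith)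
  have hyD : y * pr.D ≤ 3 * x * pr.D := by nlinarith
  have hlin : x * pr.D * q ≤ x * pr.D * (r + 5 * Rl + 15) - 1 := by
    have e1 : pr.Mabs * (aw + Rl + 1) = pr.Mabs * aw + pr.Mabs * ((Rl : ℤ) + 1) := by ring
    nlinarith
  have hle : x * pr.D * q < x * pr.D * (r + 5 * Rl + 15 + 1) := by nlinarith
  have := lt_of_mul_lt_mul_left hle hxD.le
  linarith

/-- The T cells underneath a V structure whose fine cells are `fcellsA`: `P.r/P.s/P.K` read off `fcellsA` (`KS.cells_of_hP` through `toPCells2T`). [folklore] -/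
theorem cells_of_hPV (g : ℕ) (P : PCells2V) (hP : P.toPCells2 = fcellsA κ Φ t p D g f) :
    (∀ i, (P.r i : ℤ) = ((fcellsA κ Φ t p D g f).r i : ℤ)) ∧ (∀ i, P.s i = (fcellsA κ Φ t p D g f).s i) ∧ P.K = (fcellsA κ Φ t p D g f).K :=
  KS.cells_of_hP κ Φ t p D g f P.toPCells2T hP

/-- **`hRlev` at the V cells**: `Rlev0 + 4 ≤ 10 · P.s i`, from the box floor. [folklore] -/
theorem frame_hRlevV (hN : EqNumL κ Φ t p D (KS.gT mk gx κ Φ t p D) f) (hκ : (hL κ Φ t p D (KS.gT mk gx κ Φ t p D) f).natAbs ≤ 10 * nL κ Φ t p D (KS.gT mk gx κ Φ t p D) f)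
    (hMR0 : 4 * Neg.K κ * (KS0.R'0 κ Φ t p D mk + 2) ≤ ML κ Φ t p D (KS.gT mk gx κ Φ t p D))
    (P : PCells2V) (hP : P.toPCells2 = fcellsA κ Φ t p D (KS.gT mk gx κ Φ t p D) f) (i : Fin 2) :
    KS0.Rlev0 κ Φ t p D mk + 4 ≤ 10 * P.s i := by
  obtain ⟨-, hs, -⟩ := cells_of_hPV κ Φ t p D f (KS.gT mk gx κ Φ t p D) P hP
  rw [hs i]
  exact (hRlev_R0_of_box κ Φ t p D f mk gx hN hκ hMR0 i).1

/-- **`hRlev'` at the V cells (creep-aware)**: `Rlev0 + 5 + P.c du.1 ≤ 3 · P.r (oth du.1)`. [folklore] -/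
theorem frame_hRlev'V (hN : EqNumL κ Φ t p D (KS.gT mk gx κ Φ t p D) f) (hκ : (hL κ Φ t p D (KS.gT mk gx κ Φ t p D) f).natAbs ≤ 10 * nL κ Φ t p D (KS.gT mk gx κ Φ t p D) f)
    (hMR0 : 4 * Neg.K κ * (KS0.R'0 κ Φ t p D mk + 2) ≤ ML κ Φ t p D (KS.gT mk gx κ Φ t p D))
    (P : PCells2V) (hP : P.toPCells2 = fcellsA κ Φ t p D (KS.gT mk gx κ Φ t p D) f) (du : MDir) :
    (KS0.Rlev0 κ Φ t p D mk : ℤ) + 5 + P.c du.1 ≤ 3 * P.r (oth du.1) := by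
  obtain ⟨hr, -, -⟩ := cells_of_hPV κ Φ t p D f (KS.gT mk gx κ Φ t p D) P hP
  obtain ⟨-, hu, hru⟩ := uA_oth_factsR0 κ Φ t p D f mk gx hN hκ hMR0 du.1
  have hc : P.c du.1 ≤ (P.r (oth du.1) : ℤ) := P.toPCells2T.c_le_r_oth' du.1
  have hR := (KS0.R'0_eq κ Φ t p D mk).2.1
  have hR' : (KS0.Rlev0 κ Φ t p D mk : ℤ) + 1 = (KS0.R'0 κ Φ t p D mk : ℤ) := by exact_mod_cast hR
  change (KS0.Rlev0 κ Φ t p D mk : ℤ) + 5 + P.toPCells2T.c du.1 ≤ 3 * (P.toPCells2T.r (oth du.1) : ℤ)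
  have hr' : (P.toPCells2T.r (oth du.1) : ℤ) = ((fcellsA κ Φ t p D (KS.gT mk gx κ Φ t p D) f).r (oth du.1) : ℤ) := hr (oth du.1)
  rw [hr'] at hc ⊢
  set u := (if oth du.1 = 0 then KS.u₀A κ Φ t p D (KS.gT mk gx κ Φ t p D) f else KS.u₁A κ Φ t p D (KS.gT mk gx κ Φ t p D) f)
  linarith

/-- **`hk₀` at `k₀ := 3`** (P-free; FaceLatA). [folklore] -/
theorem frame_hk₀V (hN : EqNumL κ Φ t p D (KS.gT mk gx κ Φ t p D) f) (hκ : (hL κ Φ t p D (KS.gT mk gx κ Φ t p D) f).natAbs ≤ 10 * nL κ Φ t p D (KS.gT mk gx κ Φ t p D) f)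
    (I : Fin 2) :
    (prFA κ Φ t p D (KS.gT mk gx κ Φ t p D) f).rdN I ((prFA κ Φ t p D (KS.gT mk gx κ Φ t p D) f).bOf I) ≤
      (prFA κ Φ t p D (KS.gT mk gx κ Φ t p D) f).rdK I ((prFA κ Φ t p D (KS.gT mk gx κ Φ t p D) f).bOf I) * 3 :=
  rdN_le_three_rdKA κ Φ t p D _ f hN I (eleven_le_s_TA κ Φ t p D f mk gx hN hκ I)

/-- **`hk₀'` at the V cells** (`k₀ := 3`): `3 · P.r i + 3 + 3 ≤ 5 · P.r i`. [folklore] -/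
theorem frame_hk₀'V (hN : EqNumL κ Φ t p D (KS.gT mk gx κ Φ t p D) f) (hκ : (hL κ Φ t p D (KS.gT mk gx κ Φ t p D) f).natAbs ≤ 10 * nL κ Φ t p D (KS.gT mk gx κ Φ t p D) f)
    (P : PCells2V) (hP : P.toPCells2 = fcellsA κ Φ t p D (KS.gT mk gx κ Φ t p D) f) (i : Fin 2) :
    3 * (P.r i : ℤ) + 3 + 3 ≤ 5 * P.r i := by
  obtain ⟨hr, -, -⟩ := cells_of_hPV κ Φ t p D f (KS.gT mk gx κ Φ t p D) P hP
  rw [show (P.r i : ℤ) = ((fcellsA κ Φ t p D (KS.gT mk gx κ Φ t p D) f).r i : ℤ) from hr i]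
  exact hk₀'_RA κ Φ t p D f mk gx hN hκ (k₀ := 3) le_rfl i

/-- **`hroomF` at the RE-SIZED window** (level `Rlev0`): `aw du := (awF₂V P du).toNat`, `kF := kFF₂V P Rlev0` (`Skelφ.FinePrm.hroomF_kFF₂V`). [cite: KozmaNitzan2024, §4 Lemma 12 (pp. 23–25)] -/
theorem frame_hroomFV (hN : EqNumL κ Φ t p D (KS.gT mk gx κ Φ t p D) f) (P : PCells2V) (du : MDir) :
    (prFA κ Φ t p D (KS.gT mk gx κ Φ t p D) f).Mabs *
          (((((prFA κ Φ t p D (KS.gT mk gx κ Φ t p D) f).awF₂V P du).toNat : ℕ) : ℤ) + (KS0.Rlev0 κ Φ t p D mk : ℤ) + 1) +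
        (prFA κ Φ t p D (KS.gT mk gx κ Φ t p D) f).rdN du.1 ((prFA κ Φ t p D (KS.gT mk gx κ Φ t p D) f).bOf du.1) * ((KS0.Rlev0 κ Φ t p D mk : ℤ) + 2) *
          (prFA κ Φ t p D (KS.gT mk gx κ Φ t p D) f).D ≤
      (prFA κ Φ t p D (KS.gT mk gx κ Φ t p D) f).rdK du.1 ((prFA κ Φ t p D (KS.gT mk gx κ Φ t p D) f).bOf du.1) *
        (prFA κ Φ t p D (KS.gT mk gx κ Φ t p D) f).kFF₂V P (KS0.Rlev0 κ Φ t p D mk) du.1 * (prFA κ Φ t p D (KS.gT mk gx κ Φ t p D) f).D := by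
  set pr := prFA κ Φ t p D (KS.gT mk gx κ Φ t p D) f
  obtain ⟨hc₀, hc₁⟩ := prFA_c_pos κ Φ t p D (KS.gT mk gx κ Φ t p D) f
  have hDd := prFA_D κ Φ t p D (KS.gT mk gx κ Φ t p D) f
  have hDpos := prFA_D_pos κ Φ t p D (KS.gT mk gx κ Φ t p D) f hN
  have hM := pr.Mabs_pos hc₀ hc₁ hDd hDpos
  have hnn : 0 ≤ pr.awF₂V P du := by
    have hfe : ∀ i : Fin 2, 0 ≤ P.faceExt du i := fun i => by
      unfold PCells2V.faceExt; split_ifs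
      · exact le_rfl
      · have h3 : (0 : ℤ) ≤ P.hB du.1 := Nat.cast_nonneg _; have h4 : (0 : ℤ) ≤ P.hF du.1 := Nat.cast_nonneg _; omega
    have hrd : ∀ I b, 0 ≤ pr.rdK I b := fun I b => by
      unfold Skelφ.FinePrm.rdK; exact mul_nonneg (pr.cOf_pos hc₀ hc₁ I).le (abs_nonneg _)
    have hnum : 0 ≤ pr.awNumV P du := by
      unfold Skelφ.FinePrm.awNumV
      have := hfe 0; have := hfe 1; have := hrd 1 (pr.bOf du.1); have := hrd 0 (pr.bOf du.1)
      positivity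
    unfold Skelφ.FinePrm.awF₂V
    exact Int.ediv_nonneg (by linarith) hM.le
  rw [Int.toNat_of_nonneg hnn]
  exact pr.hroomF_kFF₂V hc₀ hc₁ hDd hDpos P (KS0.Rlev0 κ Φ t p D mk) du

/-- **`haw` at the RE-SIZED window** (`Skelφ.FinePrm.haw_awF₂V`, over the NEW `PCells2V.faceExt`) with `aw du := (awF₂V P du).toNat`. [cite: KozmaNitzan2024, §4 Lemma 12 (pp. 23–25)] -/
theorem frame_hawV (hN : EqNumL κ Φ t p D (KS.gT mk gx κ Φ t p D) f) (P : PCells2V) (du : MDir) :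
    ((prFA κ Φ t p D (KS.gT mk gx κ Φ t p D) f).rdK 1 ((prFA κ Φ t p D (KS.gT mk gx κ Φ t p D) f).bOf du.1) * (P.faceExt du 0 + 1) +
          (prFA κ Φ t p D (KS.gT mk gx κ Φ t p D) f).rdK 0 ((prFA κ Φ t p D (KS.gT mk gx κ Φ t p D) f).bOf du.1) * (P.faceExt du 1 + 1)) *
        (prFA κ Φ t p D (KS.gT mk gx κ Φ t p D) f).D ≤
      (prFA κ Φ t p D (KS.gT mk gx κ Φ t p D) f).Mabs *
        (((((prFA κ Φ t p D (KS.gT mk gx κ Φ t p D) f).awF₂V P du).toNat : ℕ) : ℤ) + 1) := by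
  set pr := prFA κ Φ t p D (KS.gT mk gx κ Φ t p D) f
  obtain ⟨hc₀, hc₁⟩ := prFA_c_pos κ Φ t p D (KS.gT mk gx κ Φ t p D) f
  have hDd := prFA_D κ Φ t p D (KS.gT mk gx κ Φ t p D) f
  have hDpos := prFA_D_pos κ Φ t p D (KS.gT mk gx κ Φ t p D) f hN
  have h := pr.haw_awF₂V hc₀ hc₁ hDd hDpos P du
  have hto : pr.awF₂V P du ≤ (((pr.awF₂V P du).toNat : ℕ) : ℤ) := Int.self_le_toNat _
  have hM := pr.Mabs_pos hc₀ hc₁ hDd hDpos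
  nlinarith

/-- **`hkF` at the RE-SIZED window, DESIGN W's shape with the extra `r⊥`**: `kFF₂V P Rlev0 I + 3 + P.c I + P.r (oth I) ≤ 5 · P.r (oth I)`
(`kFF₂V ≤ eV + 5Rlev0 + 15`, `eV ≤ 2r⊥`, `c ≤ r⊥`, `Rlev0 + 1 = R'0`, `6R'0 + 11 ≤ u_⊥`, `40u_⊥ ≤ r_⊥`). [cite: KozmaNitzan2024, §4 Lemma 10 Step IV] -/
theorem frame_hkFV (hN : EqNumL κ Φ t p D (KS.gT mk gx κ Φ t p D) f) (hκ : (hL κ Φ t p D (KS.gT mk gx κ Φ t p D) f).natAbs ≤ 10 * nL κ Φ t p D (KS.gT mk gx κ Φ t p D) f)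
    (hMR0 : 4 * Neg.K κ * (KS0.R'0 κ Φ t p D mk + 2) ≤ ML κ Φ t p D (KS.gT mk gx κ Φ t p D))
    (P : PCells2V) (hP : P.toPCells2 = fcellsA κ Φ t p D (KS.gT mk gx κ Φ t p D) f) (I : Fin 2) :
    (prFA κ Φ t p D (KS.gT mk gx κ Φ t p D) f).kFF₂V P (KS0.Rlev0 κ Φ t p D mk) I + 3 + P.c I + P.r (oth I) ≤ 5 * (P.r (oth I) : ℤ) := by
  obtain ⟨hr, -, -⟩ := cells_of_hPV κ Φ t p D f (KS.gT mk gx κ Φ t p D) P hP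
  have hq := kFF₂V_le_lin κ Φ t p D f mk gx hN hκ P (KS0.Rlev0 κ Φ t p D mk) I
  obtain ⟨he0, he2⟩ := faceExtV_oth_bounds P I
  obtain ⟨-, hu, hru⟩ := uA_oth_factsR0 κ Φ t p D f mk gx hN hκ hMR0 I
  have hc : P.c I ≤ (P.r (oth I) : ℤ) := P.toPCells2T.c_le_r_oth' I
  have hR := (KS0.R'0_eq κ Φ t p D mk).2.1
  have hR' : (KS0.Rlev0 κ Φ t p D mk : ℤ) + 1 = (KS0.R'0 κ Φ t p D mk : ℤ) := by exact_mod_cast hR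
  change _ + 3 + P.toPCells2T.c I + (P.toPCells2T.r (oth I) : ℤ) ≤ 5 * (P.toPCells2T.r (oth I) : ℤ)
  have hr' : (P.toPCells2T.r (oth I) : ℤ) = ((fcellsA κ Φ t p D (KS.gT mk gx κ Φ t p D) f).r (oth I) : ℤ) := hr (oth I)
  have he2' : P.faceExt (I, true) (oth I) ≤ 2 * ((fcellsA κ Φ t p D (KS.gT mk gx κ Φ t p D) f).r (oth I) : ℤ) := by rw [← hr']; exact he2
  rw [hr'] at hc ⊢
  set q := (prFA κ Φ t p D (KS.gT mk gx κ Φ t p D) f).kFF₂V P (KS0.Rlev0 κ Φ t p D mk) I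
  set e := P.faceExt (I, true) (oth I)
  set u := (if oth I = 0 then KS.u₀A κ Φ t p D (KS.gT mk gx κ Φ t p D) f else KS.u₁A κ Φ t p D (KS.gT mk gx κ Φ t p D) f)
  linarith

/-- **`hnC`/`hU3`** (P-free; FaceRoomsA `nFc_RA`) at `nFc I := (pr.cOf I · |pr.A| · |pr.lvGen I (pr.bOf I)|).toNat`. [folklore] -/
theorem frame_nFcV (hN : EqNumL κ Φ t p D (KS.gT mk gx κ Φ t p D) f) (hκ : (hL κ Φ t p D (KS.gT mk gx κ Φ t p D) f).natAbs ≤ 10 * nL κ Φ t p D (KS.gT mk gx κ Φ t p D) f)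
    (I : Fin 2) :
    ((((prFA κ Φ t p D (KS.gT mk gx κ Φ t p D) f).cOf I * |(prFA κ Φ t p D (KS.gT mk gx κ Φ t p D) f).A| *
            |(prFA κ Φ t p D (KS.gT mk gx κ Φ t p D) f).lvGen I ((prFA κ Φ t p D (KS.gT mk gx κ Φ t p D) f).bOf I)|).toNat : ℕ) : ℤ) ≤
        (prFA κ Φ t p D (KS.gT mk gx κ Φ t p D) f).cOf I * |(prFA κ Φ t p D (KS.gT mk gx κ Φ t p D) f).A| *
          |(prFA κ Φ t p D (KS.gT mk gx κ Φ t p D) f).lvGen I ((prFA κ Φ t p D (KS.gT mk gx κ Φ t p D) f).bOf I)| ∧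
      (prFA κ Φ t p D (KS.gT mk gx κ Φ t p D) f).D ≤
        3 * ((((prFA κ Φ t p D (KS.gT mk gx κ Φ t p D) f).cOf I * |(prFA κ Φ t p D (KS.gT mk gx κ Φ t p D) f).A| *
            |(prFA κ Φ t p D (KS.gT mk gx κ Φ t p D) f).lvGen I ((prFA κ Φ t p D (KS.gT mk gx κ Φ t p D) f).bOf I)|).toNat : ℕ) : ℤ) := by
  obtain ⟨h0, h3⟩ := nFc_RA κ Φ t p D f mk gx hN hκ I
  rw [Int.toNat_of_nonneg h0]
  exact ⟨le_rfl, h3⟩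

end FrameRowsV

end NegB

end PlanarSkeletonFrm

end Summit.CriticalPhenomena.PercolationContinuityZ3.Theorems.Transplant

end
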